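import Summits.CriticalPhenomena.PercolationContinuityZ3.Theorems.Transplant.PlanarSkeletonFrmFromReflect
import Summits.CriticalPhenomena.PercolationContinuityZ3.Theorems.Transplant.SkelFrmFrom1Closure
import Summits.CriticalPhenomena.PercolationContinuityZ3.Theorems.Transplant.PlanarSkeletonFrmFromDefs
import Summits.CriticalPhenomena.PercolationContinuityZ3.Theorems.Transplant.SkelFrm1Closure
import Summits.CriticalPhenomena.PercolationContinuityZ3.Theorems.Transplant.SkelFrmFrom1SlotTypes
import Summits.CriticalPhenomena.PercolationContinuityZ3.Theorems.Transplant.SkelFrm1SlotTypes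
import Summits.CriticalPhenomena.PercolationContinuityZ3.Theorems.Transplant.PlanarSkeletonFrmReflect
import Summits.CriticalPhenomena.PercolationContinuityZ3.Theorems.Transplant.SkelPhiReflect
import HarnessLib
import Summits.CriticalPhenomena.PercolationContinuityZ3.Theorems.Transplant.SkelFrm1Normalise
/-!
# U-WAVE PORT (RULING D-U, lead g21 2026-08-26; WAVE-U-MANIFEST v3.0 row «SkelFrm1Normalise» ↦ «SkelFrmFrom1Normalise») of the tree module
# `Transplant/SkelFrm1Normalise` onto the carrier `PlanarSkeletonFrmFrom` (frames only, cylinders connected from width `ℓ₀` on)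

ORIGINAL TITLE: N2 (the frames-only node `SamePDropOfSkeletonFrm₁`, OPEN), WAVE 0 (c2) file 2: THE QUADRANT NORMALISATION — reflection covariance of the Step-I‴ records, the

builds on p205010 (kernel theorem, internal audit signed; external expert review pending) — nothing in this file uses p205010; NOTHING is claimed about the
OPEN node U `SamePDropOfSkeletonFrmFrom₁` (nor U_s / the end state).  Lane `prim-bschramm`, seat `prim-bschramm-p3` gen 26; helper file
(`--supports stmt-CriticalPhenomena-4575 --as helper`).  PORT RULES r1–r4 of RULING D-U: declaration order and proof texts are those of the original,
byte-identical except (i) the carrier token `PlanarSkeletonFrm ↦ PlanarSkeletonFrmFrom` (binders, `namespace`/`end` lines, qualified names of twinned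
declarations), (ii) carrier-FREE declarations of the original (φ-level `Skelφ…` blocks and namespace-only arithmetic residents) are NOT re-declared —
this file imports the original and `export`s the twin-free residents (POLICY T / treatment (m1)); residents whose statement mentions a twinned
constant are copied, (iii) every carrier-binding declaration keeps its explicit binder `(Φ : PlanarSkeletonFrmFrom G)` in its own signature (r2).  Docstrings and citations are the original's.
-/

noncomputable section

open MeasureTheory ProbabilityTheory
open scoped ENNReal Classical

namespace Summit.CriticalPhenomena.PercolationContinuityZ3.Theorems.Transplant

open Literature.Probability.Percolation Literature.Probability.LatticeModels SimpleGraph KNLevels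
open Literature.Barriers.CriticalPhenomena (HasExponentialGrowth)

/-! ## §1 Chart level: transposition, finsets, and the fat radius under reflection -/

namespace Skelφ

variable {V : Type} {G : SimpleGraph V} {φ : V → Site 2} {types : Finset V}

variable [G.LocallyFinite]

end Skelφ

/-! ## §2 Record level: the reflected records, piece/region/event covariance, the geometric clause, quadrants, family transport -/

namespace Skelφ.StepI

variable {V : Type} {G : SimpleGraph V} {φ : V → Site 2} {types : Finset V}

variable [G.LocallyFinite]

end Skelφ.StepI

/-! ## §3 The record with selectors as the column reads it, its facts, and the closure over it -/

namespace Skelφ.StepI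

variable {V : Type} {G : SimpleGraph V}

end Skelφ.StepI

namespace PlanarSkeletonFrmFrom

variable {V : Type} {G : SimpleGraph V} [G.LocallyFinite]

/-- **THE CLOSURE OF THE FRAMES-ONLY NODE OVER THE NORMALISED RECORD (single type).**  Suppose that for every locally finite `G` NOT of exponential growth with a one-type
`PlanarSkeletonFrm Φ` (`Φ.types = {t}`), every `0 < p < 1` with a.s. uniqueness, Φ2 (`hC`) and `θ_t(p) > 0`, the instance names `0 < δI < 1` and `m₀`; receives a record
WITH SELECTORS `O : OutNS V` satisfying `O.FactsNS Φ.frame hC m₀ t` — in particular the served quadrant at every selected pair is `(E, N)` and the orientation is constant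
there; returns admissible finite lists `Sz`, `SMn`; and at every `q ∈ [p/2, p]` where the oriented family over `indexNQ {t} Sz SMn (sgQ O.qd O.qdT O.ori)` holds with
accuracy `δI` and Φ2 holds, proves `θ_t(q) > 0`.  Then `SamePDropOfSkeletonFrm₁`.  (Proof: from `samePDropOfSkeletonFrm₁_of_stepI_frQ` by the quadrant normalisation —
cofinal colour, `Φ.reflect s`, `DataNS.ofSel (·.reflectRec s)`, covariance §1–§2; `δI`/`m₀` are the min/max over the four sign vectors.)
[cite: KozmaNitzan2024, §1 p. 2 (approach 1); §4 Theorem 6 (pp. 25–31), p. 16 (Lemma 8), p. 17] [cite: MartineauTassion2017, §3.2 Lemma 3.2, §3.3 Lemma 3.7] -/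
theorem samePDropOfSkeletonFrmFrom₁_of_stepI_outNS
    (h : ∀ {V : Type} [DecidableEq V] [Countable V] (G : SimpleGraph V) [G.LocallyFinite] (Φ : PlanarSkeletonFrmFrom G),
      ¬ HasExponentialGrowth G → ∀ t ∈ Φ.types, Φ.types = {t} → ∀ p : unitInterval, 0 < (p : ℝ) → (p : ℝ) < 1 →
        (∀ᵐ ω ∂bondPercolation G p, numInfiniteClusters ω ≤ 1) → ∀ hC : Φ.CylSubcritical p, 0 < theta G t p →
          ∃ (δI : ℝ) (m₀ : ℕ), 0 < δI ∧ δI < 1 ∧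
            ∀ O : Skelφ.StepI.OutNS V, O.FactsNS (G := G) Φ.frame hC m₀ t →
              ∃ (Sz : Finset ℕ) (SMn : Finset (ℕ × ℕ)), (∀ M ∈ Sz, O.D.M₀ ≤ M) ∧ (∀ q ∈ SMn, O.D.M₀ ≤ q.1 ∧ O.D.n₁ q.1 ≤ q.2) ∧
                ∀ q : unitInterval, (p : ℝ) / 2 ≤ q → (q : ℝ) ≤ p →
                  (∀ i ∈ Skelφ.StepI.indexNQ {t} Sz SMn (Skelφ.StepI.sgQ O.qd O.qdT O.ori),
                    1 - δI < (bondPercolation G q).real (Skelφ.StepI.eventO G Φ.φ O.D.toDataN O.DT.toDataN O.ori i)) →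
                  Φ.CylSubcritical q → 0 < theta G t q) :
    SamePDropOfSkeletonFrmFrom₁ := by
  refine samePDropOfSkeletonFrmFrom₁_of_stepI_frQ fun {V} _ _ G _ Φ hg t ht h1 p hp0 hp1 hU hC hθ => ?_
  -- the hypothesis at each of the four reflected skeletons, up front
  have hall : ∀ s : Fin 2 → ℤˣ, ∃ (δI : ℝ) (m₀ : ℕ), 0 < δI ∧ δI < 1 ∧
      ∀ O : Skelφ.StepI.OutNS V, O.FactsNS (G := G) (Φ.reflect s).frame ((Φ.reflect_cylSubcritical_iff s p).2 hC) m₀ t →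
        ∃ (Sz : Finset ℕ) (SMn : Finset (ℕ × ℕ)), (∀ M ∈ Sz, O.D.M₀ ≤ M) ∧ (∀ q ∈ SMn, O.D.M₀ ≤ q.1 ∧ O.D.n₁ q.1 ≤ q.2) ∧
          ∀ q : unitInterval, (p : ℝ) / 2 ≤ q → (q : ℝ) ≤ p →
            (∀ i ∈ Skelφ.StepI.indexNQ {t} Sz SMn (Skelφ.StepI.sgQ O.qd O.qdT O.ori),
              1 - δI < (bondPercolation G q).real (Skelφ.StepI.eventO G (Φ.reflect s).φ O.D.toDataN O.DT.toDataN O.ori i)) →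
            (Φ.reflect s).CylSubcritical q → 0 < theta G t q :=
    fun s => h G (Φ.reflect s) hg t ht h1 p hp0 hp1 hU ((Φ.reflect_cylSubcritical_iff s p).2 hC) hθ
  choose δIf m₀f hδIf0 hδIf1 hrest using hall
  obtain ⟨s₀, -, hs₀⟩ := Finset.exists_min_image Finset.univ δIf ⟨1, Finset.mem_univ _⟩
  refine ⟨δIf s₀, Finset.univ.sup m₀f, hδIf0 s₀, hδIf1 s₀, ?_⟩
  intro D DT qd qdT ori hk₀ hk₁ hkM hR hΛ e1 e2 e3 e4 e5 hgeom
  -- admissibility and colour; a cofinal colour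
  let adm : ℕ → ℕ → Prop := fun M n => D.M₀ ≤ M ∧ D.n₁ M ≤ n
  let col : ℕ → ℕ → Bool × (ℤˣ × ℤˣ) := fun M n => (ori t M n, if ori t M n = true then qd t M n else qdT t M n)
  have hadm : Skelφ.ScaleSel.AdmCofinal adm D.M₀ := fun M hM N => ⟨max N (D.n₁ M), le_max_left _ _, hM, le_max_right _ _⟩
  obtain ⟨c, hc⟩ := Skelφ.ScaleSel.exists_colourCofinal hadm col
  -- the normalising signs and the reflected skeleton
  let s : Fin 2 → ℤˣ := if c.1 = true then ![c.2.1, c.2.2] else ![c.2.2, c.2.1]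
  set Ψ : PlanarSkeletonFrmFrom G := Φ.reflect s with hΨ
  have hCΨ : Ψ.CylSubcritical p := (Φ.reflect_cylSubcritical_iff s p).2 hC
  -- the record with selectors of the reflected skeleton
  let Ds : Skelφ.StepI.DataNS V := Skelφ.StepI.DataNS.ofSel (D.reflectRec s) hc
  let DTs : Skelφ.StepI.DataNS V := Skelφ.StepI.DataNS.ofSel (DT.reflectRec s) hc
  let O : Skelφ.StepI.OutNS V := ⟨Ds, DTs, ori, Skelφ.StepI.qdR s qd, Skelφ.StepI.qdTR s qdT⟩
  -- its facts
  have hcol : ∀ M₁ N, ori t (Ds.sM M₁) (Ds.sN M₁ N) = c.1 ∧ (if ori t (Ds.sM M₁) (Ds.sN M₁ N) = true then qd t (Ds.sM M₁) (Ds.sN M₁ N)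
      else qdT t (Ds.sM M₁) (Ds.sN M₁ N)) = c.2 := fun M₁ N => by
    have := (Skelφ.StepI.DataNS.ofSel_adm_col (D.reflectRec s) hc M₁ N).2
    exact ⟨congrArg Prod.fst this, congrArg Prod.snd this⟩
  have hfacts : O.FactsNS (G := G) Ψ.frame hCΨ (m₀f s) t := by
    refine ⟨⟨(Finset.le_sup (f := m₀f) (Finset.mem_univ s)).trans hk₀, hk₁, hkM, ?_, ?_, e1, e2, e3, e4, e5, fun M hM n hn => ?_⟩, ?_, ?_, ?_, ⟨rfl, rfl⟩⟩
    · show D.R = Skelφ.fatRadius Ψ.frame _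
      rw [hR]; exact (funext (Skelφ.fatRadius_reflφ (φ := Φ.φ) (types := Φ.types) s Φ.frame hC Ψ.frame hCΨ)).symm
    · show D.Λ = Skelφ.fatSeq Ψ.frame _
      rw [hΛ]; exact (Skelφ.fatSeq_reflφ (φ := Φ.φ) (types := Φ.types) s Φ.frame hC Ψ.frame hCΨ).symm
    · obtain ⟨ha, hb⟩ := hgeom M hM n hn
      refine ⟨fun ho => ⟨Skelφ.StepI.eqGeom_reflφ s (ha ho).1, ?_⟩, fun ho => ⟨Skelφ.StepI.eqGeom_reflφ_tr s (hb ho).1, ?_⟩⟩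
      · show ((s 0 : ℤ) * (s 1 : ℤ) * D.hgt t M n).natAbs ≤ 10 * n
        rw [Skelφ.natAbs_reflHgt]; exact (ha ho).2
      · show ((s 0 : ℤ) * (s 1 : ℤ) * DT.hgt t M n).natAbs ≤ 10 * n
        rw [Skelφ.natAbs_reflHgt]; exact (hb ho).2
    · intro M₁ N
      exact (Skelφ.StepI.DataNS.ofSel_adm_col (D.reflectRec s) hc M₁ N).1
    · intro M₁ N
      obtain ⟨ho, hq⟩ := hcol M₁ N
      show (if ori t (Ds.sM M₁) (Ds.sN M₁ N) = true then Skelφ.StepI.qdR s qd t (Ds.sM M₁) (Ds.sN M₁ N)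
        else Skelφ.StepI.qdTR s qdT t (Ds.sM M₁) (Ds.sN M₁ N)) = (1, 1)
      obtain ⟨b, σ₀, σ₁⟩ := c
      simp only at ho hq
      cases b
      · rw [ho] at hq ⊢
        simp only [Bool.false_eq_true, ↓reduceIte] at hq ⊢
        simp only [Skelφ.StepI.qdTR, hq, s, Bool.false_eq_true, ↓reduceIte, Matrix.cons_val_zero, Matrix.cons_val_one,
          Skelφ.StepI.units_mul_self', Prod.mk_one_one]
      · rw [ho] at hq ⊢
        simp only [↓reduceIte] at hq ⊢
        simp only [Skelφ.StepI.qdR, hq, s, ↓reduceIte, Matrix.cons_val_zero, Matrix.cons_val_one, Skelφ.StepI.units_mul_self', Prod.mk_one_one]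
    · intro M₁ N M₁' N'
      show ori t (Ds.sM M₁) (Ds.sN M₁ N) = ori t (Ds.sM M₁') (Ds.sN M₁' N')
      rw [(hcol M₁ N).1, (hcol M₁' N').1]
  -- the residues' answer for the reflected skeleton, transported back
  obtain ⟨Sz, SMn, hSz, hSMn, hend⟩ := hrest s O hfacts
  refine ⟨Sz, SMn, hSz, hSMn, fun q hq1 hq2 hfam hCq => hend q hq1 hq2 ?_ ((Φ.reflect_cylSubcritical_iff s q).2 hCq)⟩
  have hmin : δIf s₀ ≤ δIf s := hs₀ s (Finset.mem_univ _)
  intro i hi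
  have := Skelφ.StepI.family_reflφ (G := G) (φ := Φ.φ) (types := ({t} : Finset V)) s D DT qd qdT ori (μ := bondPercolation G q) hfam i hi
  exact lt_of_le_of_lt (by linarith) this

end PlanarSkeletonFrmFrom

end Summit.CriticalPhenomena.PercolationContinuityZ3.Theorems.Transplant

end
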